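import Summits.RiemannHypothesis.RiemannHypothesis.Theorems.TiltedLandingLaw421R2NodeDR

/-! # TiltedLandingLaw421R2CoreP
W-08 round-2 α-CORE′ ENTRY POINTS BY NAME (sixth module, imports the landed delta module `TiltedLandingLaw421R2NodeDR` and through it the whole landed round-2 chain): C4 g24 §K.6 `NearestDropSealG`/`NearestDropSeal` block, C1 §R2Kα primed α entries (`NearestDropSeal′`, `alphaSealTrkD′_of_nearestDrop′`, …), C1 §R2Kd `HeightLemmaCore′` + K (`readyR2_of_tiltReady`, `nearestDropSealG_of_core′`, `nearestDropSeal′_of_core′`, `alphaSealTrkD′_of_core′`, …), C1 §R2Ke node `RhW08.R2Node.law421T_of_round2DFR_core′`. The registered thin `Lines/trkD_v2R.lean` d97327ed is untouched; this module is where the α hand's by-name corollary lives.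
SUPPORT module for crux `TiltedLandingLaw421` (stmt-RiemannHypothesis-24774), `--supports` only: proves no stub, no crux; fully proved (no `sorry`).
ROUND-2 α-CORE′ ENTRY image («E08″») by tenure rh-tenure-earlyapp-1 g6 — director (CA322)(3) 2026-08-30T03:10:06Z: the (CA313)(B) RE-TYPED core `RhW08.Round2.HeightLemmaCore′` (C1 WORDS-46: Tilt disjunct + ∀-minimiser tie clause, s/4 drop), its K corollaries down to `alphaSealTrkD′_of_core′ : HeightLemmaCore′ → AlphaSealTrkD′` (the α hand's by-name target: `stub_alphaSealTrkD' := RhW08.Round2.alphaSealTrkD'_of_core' heightLemma_core'`) and the node twin `RhW08.R2Node.law421T_of_round2DFR_core′ : ZRestTrkDHFR′ → HeightLemmaCore′ → TiltedLandingLaw421` (CONDITIONAL, nothing credited); the OLD §R2Kc core `HeightLemmaCore` / E08′ 645073dc is NOT included (dead: critic RESULT-6 (B), (CA322)).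
from the single rc-0 base `R1K8R2KeCheck-W08-C1-rh-idea-5-g23.lean` 9f3df855 (= BASE-A fef2bb59 byte-identical prefix ++ §R1k ++ §R2Kα ++ §R2Kc ++ §R2Kd ++ §R2Ke): decl blocks byte-verbatim, base order, dependency closure of the (CA322)(3) roots
{HeightLemmaCore', alphaSealTrkD'_of_core', law421T_of_round2DFR_core'} minus what the LANDED E05a′–E07′ (#986/#988/#991/#994) and the delta module `TiltedLandingLaw421R2NodeDR` (#p758084) already carry. K = kernel-checked lemmas about MODEL sockets (combs), not ζ/Ξ. RH is not proved. -/

-- ----- from C1 g22 TreeR1 body §R1–§R1i (+§R1h) -----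
namespace RhW08.Round1

open Complex
open RhIdea6.G17.W07C7 RhIdea6.G17.W07C7.Rev6 RhIdea6.G18.W07C8.Law421BirthS RhIdea6.G19.W07C11.Seam
open RhIdea6.G20.W07C12.Frac RhIdea6.G20.W07C12.StColP RhW07.C12.FieldSplit RhIdea6.G21.W07C13.TentMax
open RhW07.C14.TwoSided RhW07.C14.Classes RhW07.C14.Lineage RhW07.C14.Booking
open RhW07.C13.Heredity RhIdea6.G22.W07C15pre.Injection RhW07.E3.Cell
open RhW07.E3.Lit

section TrackedD

/-- theorem `stCol'_of_stTrkD` — W-08 round-2 α-core′ support (E08: C1 g22 TreeR1 body §R1–§R1i (+§R1h); C1 WORDS-46 / §R2Ke): see the module docstring and the source README. -/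
theorem stCol'_of_stTrkD {η : ℝ} {f : ℂ → ℂ} {x₀ s hmax R Hs : ℝ} {B j : ℕ} {u : ℂ}
    (h : StTrkD η f x₀ s hmax R Hs B j u) : StCol' η f x₀ s hmax R Hs B j u := by
  obtain ⟨c, h0, -, hcj, hst⟩ := h
  cases j with
  | zero => rwa [← hcj]
  | succ m => rw [← hcj]; exact (hst m (Nat.lt_succ_self m)).1

/-- theorem `stTrkD_succ` — W-08 round-2 α-core′ support (E08: C1 g22 TreeR1 body §R1–§R1i (+§R1h); C1 WORDS-46 / §R2Ke): see the module docstring and the source README. -/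
theorem stTrkD_succ {η : ℝ} {f : ℂ → ℂ} {x₀ s hmax R Hs : ℝ} {B j : ℕ} {u u' : ℂ}
    (hu : StTrkD η f x₀ s hmax R Hs B j u) (hstep : TrkStepD η f x₀ s hmax R Hs B j u u') :
    StTrkD η f x₀ s hmax R Hs B (j + 1) u' := by
  obtain ⟨c, h0, hre, hcj, hst⟩ := hu
  refine ⟨fun m => if m ≤ j then c m else u', ?_, ?_, ?_, ?_⟩
  · simp only [Nat.zero_le, if_true]
    exact h0
  · simp only [Nat.zero_le, if_true]
    exact hre
  · simp only [Nat.not_succ_le_self, if_false]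
  · intro m hm
    by_cases hmj : m + 1 ≤ j
    · have hm' : m ≤ j := by omega
      simp only [hmj, hm', if_true]
      exact hst m (by omega)
    · have hm' : m = j := by omega
      subst hm'
      simp only [Nat.not_succ_le_self, if_false, le_refl, if_true, hcj]
      exact hstep

/-- (K) a down-first step always exists from a populated finite next level (case split on «some next-level state is not higher»). -/
theorem exists_trkStepD {η : ℝ} {f : ℂ → ℂ} {x₀ s hmax R Hs : ℝ} {B j : ℕ} (u : ℂ)
    (hfin : {w : ℂ | StCol' η f x₀ s hmax R Hs B (j + 1) w}.Finite) (hne : ∃ w : ℂ, StCol' η f x₀ s hmax R Hs B (j + 1) w) :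
    ∃ u' : ℂ, TrkStepD η f x₀ s hmax R Hs B j u u' := by
  by_cases hdn : ∃ w : ℂ, StCol' η f x₀ s hmax R Hs B (j + 1) w ∧ w.im ≤ u.im
  · have hfin' : {w : ℂ | StCol' η f x₀ s hmax R Hs B (j + 1) w ∧ w.im ≤ u.im}.Finite :=
      hfin.subset fun w hw => hw.1
    have hne' : hfin'.toFinset.Nonempty := by
      obtain ⟨w, hw⟩ := hdn
      exact ⟨w, (Set.Finite.mem_toFinset hfin').mpr hw⟩
    obtain ⟨u', hu', hmin⟩ := hfin'.toFinset.exists_min_image (fun w : ℂ => ‖w - u‖) hne'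
    have hu'' := (Set.Finite.mem_toFinset hfin').mp hu'
    exact ⟨u', hu''.1, Or.inl ⟨hu''.2, fun w hw hle => hmin w ((Set.Finite.mem_toFinset hfin').mpr ⟨hw, hle⟩)⟩⟩
  · push Not at hdn
    have hne' : hfin.toFinset.Nonempty := by
      obtain ⟨w, hw⟩ := hne
      exact ⟨w, (Set.Finite.mem_toFinset hfin).mpr hw⟩
    obtain ⟨u', hu', hmin⟩ := hfin.toFinset.exists_min_image (fun w : ℂ => ‖w - u‖) hne'
    exact ⟨u', (Set.Finite.mem_toFinset hfin).mp hu',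
      Or.inr ⟨fun w hw => hdn w hw, fun w hw => hmin w ((Set.Finite.mem_toFinset hfin).mpr hw)⟩⟩
end TrackedD

end RhW08.Round1

-- ----- from C4 g24 §K.5 a61232f2 -----
-- ===== BEGIN C4 g24 sectionK5-W08-C4-rh-idea-6-g24.part =====

namespace RhW08.StSwap

open RhIdea6.G17.W07C7 RhIdea6.G17.W07C7.Rev6 RhIdea6.G18.W07C8.Law421BirthS RhIdea6.G19.W07C11.Seam
open RhIdea6.G20.W07C12.Frac RhIdea6.G20.W07C12.StColP RhW07.C12.FieldSplit

/-- (K) with the not-higher pool inhabited, a down-first step IS «not higher ∧ ℂ-nearest among the not-higher» (the second branch of `TrkStepD` is void). -/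
theorem trkStepD_nearest_of_pool {η : ℝ} {f : ℂ → ℂ} {x₀ s hmax R Hs : ℝ} {B m : ℕ} {u u' : ℂ}
    (h : RhW08.Round1.TrkStepD η f x₀ s hmax R Hs B m u u') (hpool : ∃ w : ℂ, StCol' η f x₀ s hmax R Hs B (m + 1) w ∧ w.im ≤ u.im) :
    u'.im ≤ u.im ∧ ∀ w : ℂ, StCol' η f x₀ s hmax R Hs B (m + 1) w → w.im ≤ u.im → ‖u' - u‖ ≤ ‖w - u‖ := by
  obtain ⟨w, hw, hwle⟩ := hpool
  rcases h.2 with hdn | hup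
  · exact hdn
  · exact absurd (hup.1 w hw) (not_lt.mpr hwle)

/-- **`NearestDropSealG μ P Ready`** — COLUMN-ONLY α (no tracking inside): at every `P`-sealed non-`Ready` AMBIENT state `v` of level `j`, the pool of
level-`(j+1)` ambient states NOT HIGHER than `v` is inhabited, and EVERY member of it that is ℂ-nearest to `v` (among the pool) lies lower by at least `μ s`. -/
def NearestDropSealG (μ : ℝ) (P Ready : StatePred) : Prop :=
  ∀ (η : ℝ) (f : ℂ → ℂ) (x₀ s hmax R Hs : ℝ) (B : ℕ), EngineHyps5 2 η f x₀ s hmax R Hs B →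
    ∀ (j : ℕ) (v : ℂ), StCol' η f x₀ s hmax R Hs B j v → ¬ Ready η f x₀ s hmax R Hs B j v → P η f x₀ s hmax R Hs B j v →
      (∃ w : ℂ, StCol' η f x₀ s hmax R Hs B (j + 1) w ∧ w.im ≤ v.im) ∧
      ∀ w : ℂ, StCol' η f x₀ s hmax R Hs B (j + 1) w → w.im ≤ v.im →
        (∀ w' : ℂ, StCol' η f x₀ s hmax R Hs B (j + 1) w' → w'.im ≤ v.im → ‖w - v‖ ≤ ‖w' - v‖) →
        |w.im| + μ * s ≤ |v.im|

/-- ★★★ (K) **THE BRIDGE TO THE TRACKED α**: `NearestDropSealG μ P Ready → IsolatedPairDropLowG μ P StTrkD Ready` — the down-first successor of the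
lowest tracked sealed state is a ℂ-nearest member of the not-higher pool (`exists_trkStepD`, `trkStepD_nearest_of_pool`), it is tracked (`stTrkD_succ`),
and by the column text it drops by `μ s`. -/
theorem isolatedPairDropLowG_stTrkD_of_nearestDrop {μ : ℝ} {P Ready : StatePred} (h : NearestDropSealG μ P Ready) :
    IsolatedPairDropLowG μ P RhW08.Round1.StTrkD Ready := by
  intro η f x₀ s hmax R Hs B hE j v hlow hR hP
  have hv : RhW08.Round1.StTrkD η f x₀ s hmax R Hs B j v := hlow.1
  obtain ⟨hpool, hdrop⟩ := h η f x₀ s hmax R Hs B hE j v (RhW08.Round1.stCol'_of_stTrkD hv) hR hP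
  obtain ⟨w, hw, hwle⟩ := hpool
  obtain ⟨u', hstep⟩ := RhW08.Round1.exists_trkStepD v (stColP_level_finite hE (j + 1)) ⟨w, hw⟩
  have hnear := trkStepD_nearest_of_pool hstep ⟨w, hw, hwle⟩
  exact ⟨u', RhW08.Round1.stTrkD_succ hv hstep, hdrop u' hstep.1 hnear.1 hnear.2⟩
end RhW08.StSwap

-- ----- from ## §R2Kα — ROUND-2 α ENTRY POINTS BY NAME (C1 rh-idea-5 g23; NOT OF RECORD).  Th -----
namespace RhW08.Round2

open Complex
open RhIdea6.G17.W07C7 RhIdea6.G17.W07C7.Rev6 RhIdea6.G18.W07C8.Law421BirthS RhIdea6.G19.W07C11.Seam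
open RhIdea6.G20.W07C12.Frac RhIdea6.G20.W07C12.StColP RhW07.C12.FieldSplit RhIdea6.G21.W07C13.TentMax
open RhW07.C14.TwoSided RhW07.C14.Classes RhW07.C14.Lineage RhW07.C14.Booking
open RhW07.C13.Heredity RhIdea6.G22.W07C15pre.Injection RhW07.E3.Cell
open RhW07.E3.Lit
open RhW08.Round1 RhW08.StSwap

section AlphaEntry

/-- ★ `NearestDropSeal′` — C4's column-only α text with the round-2 stop. -/
def NearestDropSeal' : Prop := NearestDropSealG (1 / 4) PSealC4 ReadyR2

/-- ★★ (K) `NearestDropSeal′ → AlphaSealTrkD′` (C4's tracked bridge, Ready-generic). -/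
theorem alphaSealTrkD'_of_nearestDrop' (h : NearestDropSeal') : AlphaSealTrkD' := isolatedPairDropLowG_stTrkD_of_nearestDrop h
end AlphaEntry

end RhW08.Round2

-- ----- from ## §R2Kd (C1 rh-idea-5 g23, 2026-08-30 ≈02:15Z) — (CA313)(B) CORE RE-TYPED TO WH -----
namespace RhW08.Round2

open Complex
open RhIdea6.G17.W07C7 RhIdea6.G17.W07C7.Rev6 RhIdea6.G18.W07C8.Law421BirthS RhIdea6.G19.W07C11.Seam
open RhIdea6.G20.W07C12.Frac RhIdea6.G20.W07C12.StColP RhW07.C12.FieldSplit RhIdea6.G21.W07C13.TentMax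
open RhW07.C14.TwoSided RhW07.C14.Classes RhW07.C14.Lineage RhW07.C14.Booking
open RhW07.C13.Heredity RhIdea6.G22.W07C15pre.Injection RhW07.E3.Cell
open RhW07.E3.Lit
open RhW08.Round1 RhW08.StSwap

section AlphaCore2

/-- ★★★ `HeightLemmaCore′` — the α hand's ONE target after (CA313)(B) (stop-token-free apart from the LAW's own matrix `TiltReady`; tracker-free; booking-free;
lowest-free): at EVERY `PSealC4`-sealed column state `u` of level `j`, EITHER level `j` is `TiltReady` (a real non-Laguerre critical point of `f⁽ʲ⁾` in range —
this is how LANDING is admitted), OR the level-(j+1) not-higher pool is inhabited AND EVERY ℂ-nearest member `w` of it sits at least `s/4` below `u`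
(TIE CLAUSE: every minimiser, because the down-first step `TrkStepD` may pick any of them). -/
def HeightLemmaCore' : Prop :=
  ∀ (η : ℝ) (f : ℂ → ℂ) (x₀ s hmax R Hs : ℝ) (B : ℕ), EngineHyps5 2 η f x₀ s hmax R Hs B →
    ∀ (j : ℕ) (u : ℂ), StCol' η f x₀ s hmax R Hs B j u → PSealC4 η f x₀ s hmax R Hs B j u →
      TiltReady η f x₀ s hmax R Hs B j u ∨
      ((∃ w : ℂ, StCol' η f x₀ s hmax R Hs B (j + 1) w ∧ w.im ≤ u.im) ∧
        ∀ w : ℂ, StCol' η f x₀ s hmax R Hs B (j + 1) w → w.im ≤ u.im →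
          (∀ w' : ℂ, StCol' η f x₀ s hmax R Hs B (j + 1) w' → w'.im ≤ u.im → ‖w - u‖ ≤ ‖w' - u‖) →
          w.im + s / 4 ≤ u.im)

/-- `TiltReady ⇒ Ready′` at the same level and state. -/
theorem readyR2_of_tiltReady {η : ℝ} {f : ℂ → ℂ} {x₀ s hmax R Hs : ℝ} {B j : ℕ} {u : ℂ}
    (h : TiltReady η f x₀ s hmax R Hs B j u) : ReadyR2 η f x₀ s hmax R Hs B j u := ⟨j, le_rfl, Or.inr h⟩

/-- ★★ (K) Core′ ⇒ C4's column-only α text for EVERY stop that `TiltReady` implies (at a non-`Ready` state the Tilt disjunct is dead). -/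
theorem nearestDropSealG_of_core' (Ready : StatePred)
    (hT : ∀ (η : ℝ) (f : ℂ → ℂ) (x₀ s hmax R Hs : ℝ) (B j : ℕ) (u : ℂ), TiltReady η f x₀ s hmax R Hs B j u → Ready η f x₀ s hmax R Hs B j u)
    (h : HeightLemmaCore') : NearestDropSealG (1 / 4) PSealC4 Ready := by
  intro η f x₀ s hmax R Hs B hE j v hv hnr hP
  rcases h η f x₀ s hmax R Hs B hE j v hv hP with hTv | ⟨hpool, hbd⟩
  · exact absurd (hT η f x₀ s hmax R Hs B j v hTv) hnr
  · refine ⟨hpool, fun w hw hwle hnear => ?_⟩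
    have hle := hbd w hw hwle hnear
    have hv0 : 0 < v.im := hv.2.2.1
    have hw0 : 0 < w.im := hw.2.2.1
    rw [abs_of_pos hw0, abs_of_pos hv0]
    linarith

/-- (K) Core′ ⇒ `NearestDropSeal′` (stop `Ready′ = ReadyR2`). -/
theorem nearestDropSeal'_of_core' (h : HeightLemmaCore') : NearestDropSeal' :=
  nearestDropSealG_of_core' ReadyR2 (fun _ _ _ _ _ _ _ _ _ _ hT => readyR2_of_tiltReady hT) h

/-- ★★★ (K) Core′ ⇒ the round-2 tracked α `AlphaSealTrkD′` (the by-name file of the α hand: `stub_alphaSealTrkD′ := alphaSealTrkD'_of_core' heightLemma_core'`). -/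
theorem alphaSealTrkD'_of_core' (h : HeightLemmaCore') : AlphaSealTrkD' := alphaSealTrkD'_of_nearestDrop' (nearestDropSeal'_of_core' h)
end AlphaCore2

end RhW08.Round2

-- ----- from ## §R2Ke (C1 rh-idea-5 g23, 2026-08-30 ≈02:35Z) — BOOKED-ROOT METER TWINS «…R′» -----
namespace RhW08.R2Node

open RhIdea6.G21.W07C13.TentMax RhW08.StSwap RhW08.Round1

/-- (K) R5ᴿ with the re-typed α core. -/
theorem law421T_of_round2DFR_core' (hR : RhW08.Round2.ZRestTrkDHFR') (hC : RhW08.Round2.HeightLemmaCore') :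
    Summit.RiemannHypothesis.RiemannHypothesis.Theses.EarlyAppointments.TiltedLandingLaw421 :=
  law421T_of_round2DFR hR (RhW08.Round2.alphaSealTrkD'_of_core' hC)
end RhW08.R2Node
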